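import Mathlib
import Summits.ValiantsHypothesis.ValiantsHypothesis.Theorems.GrenetZeonHessianRankCodimTwoLatinFrobenius
import Summits.ValiantsHypothesis.ValiantsHypothesis.Theorems.GrenetZeonHessianRankCodimTwoBorderDefs
import HarnessLib

/-!
# Crux `GrenetZeon.HessianRankCodimTwo` (stmt-ValiantsHypothesis-8061), line `good_plane`, ALL large `n`:
# the Frobenius congruences of the bordered Latin plane, I — two-variable coefficients and exponent bookkeeping

Seat val-width-8061-p1 g2 (memo `Cruxes/HessianRankCodimTwo/BorderedLatinAllN.md`, §2).  Row forms
`ℓ_I(y) = Σ_J L_{IJ} y_J` (`I, J : Option (Fin 3)`, `none` = border) of `Theorems/…BorderDefs.lean`.  This file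
supplies the two ingredients of the congruences `Φ ≡ F^p w^r`, `Ψ_{IJ} ≡ P_{J-I}^p · bordLow` (assembled in
`…BorderFrobeniusCongr.lean`):

* `coeff_pow_mul_pow_two_vars` — for linear forms `L = Σ c_K y_K`, `L' = Σ c'_K y_K` and `A ≠ B`,
  `[y_A^m y_B^n] L^m L'^n = Σ_{t ≤ n} C(m,t) C(n,t) c_A^{m-t} (c_B c'_A)^t c'_B^{n-t}` (kill the other variables,
  `coeff_killVars`, then two binomial expansions); in particular
  `[y_J^{p-2} y_{none}^r] ℓ_I^{p-2} ℓ_{none}^r = bordLow` (`coeff_bordRowForm_pow_mul_pow`);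
* the EXPONENT INEQUALITIES: `p·(Σ_I e_{g I}) ≤ (p,p,p;r)` forces `g` to be a bijection onto the core
  (`exists_of_sum_single_le_bordNuPer`), and `p(e_{J₁} + e_{J₂}) ≤ (p,p,p;r) - 2e_J` forces
  `{J₁, J₂} = {J+1, J+2}` (`le_bordNuBlock_iff`) — because the core entries are saturated and `r < p`.

VP ≠ VNP is not moved by anything here.
-/

noncomputable section

open MvPolynomial Finset

-- single-conjunct layout `Summits/ValiantsHypothesis/ValiantsHypothesis`: duplicated namespace by design
set_option linter.dupNamespace false

namespace Summit.ValiantsHypothesis.ValiantsHypothesis.Theorems.GrenetZeonHessianRankCodimTwo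

variable {R : Type*} [CommRing R]

/-! ### The entries and row forms -/

/-- Core entries: `L_{IJ} = a_{J-I}`. [folklore] -/
@[simp] theorem bordEnt_some_some (I J : Fin 3) : bordEnt R (some I) (some J) = X (J - I) := by
  simp only [bordEnt, bordCoef]
  rw [Finset.sum_eq_single (J - I)]
  · simp
  · intro d _ hd; simp [Ne.symm hd]
  · simp

/-- Unfolding lemma for `bordRowForm`. [folklore] -/
theorem bordRowForm_def (I : Option (Fin 3)) :
    bordRowForm R I =
      ∑ J : Option (Fin 3), C (bordEnt R I J) * (X J : MvPolynomial (Option (Fin 3)) (MvPolynomial (Fin 3) R)) :=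
  rfl

/-! ### Coefficients of products of powers of linear forms in two of the variables -/

section TwoVars

variable {κ : Type*} [Fintype κ] [DecidableEq κ] {A : Type*} [CommRing A]

omit [Fintype κ] in
/-- Killing the variables outside `S` (an algebra endomorphism). [folklore] -/
theorem killVars_monomial (S : Finset κ) (m : κ →₀ ℕ) (c : A) :
    aeval (fun K => if K ∈ S then (X K : MvPolynomial κ A) else 0) (monomial m c) =
      if m.support ⊆ S then monomial m c else 0 := by
  rw [aeval_monomial, algebraMap_eq]
  by_cases hm : m.support ⊆ S
  · rw [if_pos hm]
    have : (Finsupp.prod m fun K e => (if K ∈ S then (X K : MvPolynomial κ A) else 0) ^ e) =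
        Finsupp.prod m fun K e => (X K : MvPolynomial κ A) ^ e := by
      rw [Finsupp.prod, Finsupp.prod]
      exact Finset.prod_congr rfl fun K hK => by rw [if_pos (hm hK)]
    rw [this, ← monomial_eq]
  · rw [if_neg hm]
    obtain ⟨K, hKm, hKS⟩ := Finset.not_subset.mp hm
    have hzero : (Finsupp.prod m fun K e => (if K ∈ S then (X K : MvPolynomial κ A) else 0) ^ e) = 0 := by
      rw [Finsupp.prod]
      refine Finset.prod_eq_zero hKm ?_
      rw [if_neg hKS, zero_pow]
      exact Finsupp.mem_support_iff.mp hKm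
    rw [hzero, mul_zero]

omit [Fintype κ] in
/-- Killing variables outside the support of `ν` does not change the coefficient of `y^ν`. [folklore] -/
theorem coeff_killVars (S : Finset κ) (ν : κ →₀ ℕ) (hν : ν.support ⊆ S) (f : MvPolynomial κ A) :
    coeff ν (aeval (fun K => if K ∈ S then (X K : MvPolynomial κ A) else 0) f) = coeff ν f := by
  induction f using MvPolynomial.induction_on' with
  | monomial m c =>
    rw [killVars_monomial]
    by_cases hm : m.support ⊆ S
    · rw [if_pos hm]
    · rw [if_neg hm, coeff_zero, coeff_monomial, if_neg]
      rintro rfl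
      exact hm hν
  | add f g hf hg => rw [map_add, coeff_add, coeff_add, hf, hg]

/-- Killing variables on a linear form `Σ_K c_K y_K`. [folklore] -/
theorem killVars_linear (S : Finset κ) (c : κ → A) :
    aeval (fun K => if K ∈ S then (X K : MvPolynomial κ A) else 0) (∑ K, C (c K) * (X K : MvPolynomial κ A)) =
      ∑ K ∈ S, C (c K) * X K := by
  rw [map_sum]
  simp_rw [map_mul, aeval_C, aeval_X, algebraMap_eq]
  rw [← Finset.sum_subset (Finset.subset_univ S)]
  · exact Finset.sum_congr rfl fun K hK => by rw [if_pos hK]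
  · intro K _ hK
    rw [if_neg hK, mul_zero]

omit [Fintype κ] [DecidableEq κ] in
/-- A two-term product as a monomial. [folklore] -/
theorem C_mul_X_pow_mul_C_mul_X_pow {Aκ Bκ : κ} (α β : A) (i j : ℕ) :
    (C α * X Aκ) ^ i * (C β * X Bκ) ^ j =
      (monomial (Finsupp.single Aκ i + Finsupp.single Bκ j) (α ^ i * β ^ j) : MvPolynomial κ A) := by
  rw [mul_pow, mul_pow, ← map_pow, ← map_pow, X_pow_eq_monomial, X_pow_eq_monomial, C_mul_monomial,
    C_mul_monomial, monomial_mul, mul_one, mul_one]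

omit [Fintype κ] in
/-- Binomial coefficient extraction from a power of a two-term linear form:
`[y_A^i y_B^j] (α y_A + β y_B)^m = C(m,i) α^i β^j` if `i + j = m`. [folklore] -/
theorem coeff_add_pow_two_vars {Aκ Bκ : κ} (hAB : Aκ ≠ Bκ) (α β : A) {m i j : ℕ} (hij : i + j = m) :
    coeff (Finsupp.single Aκ i + Finsupp.single Bκ j)
      ((C α * X Aκ + C β * X Bκ : MvPolynomial κ A) ^ m) = (m.choose i : A) * α ^ i * β ^ j := by
  rw [add_pow, coeff_sum]
  have hterm : ∀ k ∈ range (m + 1),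
      coeff (Finsupp.single Aκ i + Finsupp.single Bκ j)
        ((C α * X Aκ) ^ k * (C β * X Bκ) ^ (m - k) * (m.choose k : MvPolynomial κ A)) =
      if k = i then (m.choose i : A) * α ^ i * β ^ j else 0 := by
    intro k hk
    rw [C_mul_X_pow_mul_C_mul_X_pow,
      show ((m.choose k : ℕ) : MvPolynomial κ A) = C ((m.choose k : ℕ) : A) by simp,
      mul_comm (monomial _ _) (C _), C_mul_monomial, coeff_monomial]
    by_cases hki : k = i
    · subst hki
      rw [if_pos (by rw [show m - k = j by omega]), if_pos rfl, show m - k = j by omega]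
      ring
    · rw [if_neg, if_neg hki]
      intro h
      have := congrArg (fun f : κ →₀ ℕ => f Aκ) h
      simp only [Finsupp.coe_add, Pi.add_apply, Finsupp.single_apply] at this
      simp [hAB.symm] at this
      exact hki this
  rw [Finset.sum_congr rfl hterm, Finset.sum_ite_eq' (range (m + 1)) i,
    if_pos (Finset.mem_range.mpr (by omega))]

/-- **Two-variable coefficient of a product of powers of two linear forms.**  For linear forms
`L = Σ c_K y_K`, `L' = Σ c'_K y_K` and `A ≠ B`:
`[y_A^m y_B^n] L^m L'^n = Σ_{t ≤ n} C(m,t) C(n,t) c_A^{m-t} (c_B c'_A)^t c'_B^{n-t}`. [folklore] -/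
theorem coeff_pow_mul_pow_two_vars {Aκ Bκ : κ} (hAB : Aκ ≠ Bκ) (c c' : κ → A) (m n : ℕ) :
    coeff (Finsupp.single Aκ m + Finsupp.single Bκ n)
      ((∑ K, C (c K) * (X K : MvPolynomial κ A)) ^ m * (∑ K, C (c' K) * (X K : MvPolynomial κ A)) ^ n) =
      ∑ t ∈ range (n + 1), ((m.choose t * n.choose t : ℕ) : A) *
        (c Aκ ^ (m - t) * (c Bκ * c' Aκ) ^ t * c' Bκ ^ (n - t)) := by
  -- kill the other variables
  have hsupp : (Finsupp.single Aκ m + Finsupp.single Bκ n).support ⊆ {Aκ, Bκ} := by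
    intro K hK
    rw [Finsupp.mem_support_iff] at hK
    simp only [Finset.mem_insert, Finset.mem_singleton]
    by_contra h
    push Not at h
    simp [Ne.symm h.1, Ne.symm h.2] at hK
  rw [← coeff_killVars {Aκ, Bκ} _ hsupp, map_mul, map_pow, map_pow, killVars_linear, killVars_linear,
    Finset.sum_pair hAB, Finset.sum_pair hAB]
  -- expand the second power (`k` = number of `y_A` taken from `L'`), extract from the first
  rw [add_pow (C (c' Aκ) * X Aκ), Finset.mul_sum, coeff_sum]
  refine Finset.sum_congr rfl fun k hk => ?_
  have hkn : k ≤ n := by have := Finset.mem_range.mp hk; omega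
  rw [C_mul_X_pow_mul_C_mul_X_pow,
    show ((n.choose k : ℕ) : MvPolynomial κ A) = C ((n.choose k : ℕ) : A) by simp,
    mul_comm (monomial _ _) (C _), C_mul_monomial, coeff_mul_monomial']
  by_cases hkm : k ≤ m
  · rw [if_pos, show Finsupp.single Aκ m + Finsupp.single Bκ n - (Finsupp.single Aκ k + Finsupp.single Bκ (n - k)) =
        Finsupp.single Aκ (m - k) + Finsupp.single Bκ k by
          ext K
          simp only [Finsupp.coe_tsub, Finsupp.coe_add, Pi.sub_apply, Pi.add_apply, Finsupp.single_apply]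
          by_cases h1 : Aκ = K
          · subst h1; simp [hAB.symm]
          · by_cases h2 : Bκ = K
            · subst h2; simp [h1]; omega
            · simp [h1, h2],
      coeff_add_pow_two_vars hAB (c Aκ) (c Bκ) (show (m - k) + k = m by omega),
      ← Nat.choose_symm hkm]
    · push_cast; ring
    · intro K
      simp only [Finsupp.coe_add, Pi.add_apply, Finsupp.single_apply]
      by_cases h1 : Aκ = K
      · subst h1; simp [hAB.symm]; omega
      · by_cases h2 : Bκ = K
        · subst h2; simp [h1]
        · simp [h1, h2]
  · rw [if_neg, Nat.choose_eq_zero_of_lt (by omega)]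
    · push_cast; ring
    · intro h
      have := h Aκ
      simp only [Finsupp.coe_add, Pi.add_apply, Finsupp.single_apply] at this
      simp [hAB.symm] at this
      omega

end TwoVars

/-- **The low part:** `[y_J^{p-2} y_{none}^r] ℓ_I^{p-2} ℓ_{none}^r = bordLow`. [folklore] -/
theorem coeff_bordRowForm_pow_mul_pow (p r : ℕ) (I J : Fin 3) :
    coeff (Finsupp.single (some J) (p - 2) + Finsupp.single none r)
      (bordRowForm R (some I) ^ (p - 2) * bordRowForm R none ^ r) = bordLow R p r I J := by
  rw [bordRowForm_def, bordRowForm_def,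
    coeff_pow_mul_pow_two_vars (Option.some_ne_none J) (bordEnt R (some I)) (bordEnt R none) (p - 2) r,
    bordLow]
  simp only [bordEnt_some_some]

/-! ### Exponent bookkeeping: the inequality pins the Frobenius part -/

section Exponents

variable {p r : ℕ}

/-- Values of the permanent exponent vector. [folklore] -/
theorem bordNuPer_apply_some (K : Fin 3) : bordNuPer p r (some K) = p := by
  simp only [bordNuPer, Finsupp.coe_add, Pi.add_apply, Finsupp.finsetSum_apply, Finsupp.single_apply,
    Option.some.injEq, reduceCtorEq, if_false, add_zero, Finset.sum_ite_eq', Finset.mem_univ, if_true]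

/-- Values of the permanent exponent vector. [folklore] -/
theorem bordNuPer_apply_none : bordNuPer p r none = r := by
  simp [bordNuPer]

/-- Values of the block exponent vector. [folklore] -/
theorem bordNuBlock_apply_some (J K : Fin 3) :
    bordNuBlock p r J (some K) = if K = J then p - 2 else p := by
  simp only [bordNuBlock, Finsupp.coe_add, Pi.add_apply, Finsupp.finsetSum_apply, Finsupp.single_apply,
    Option.some.injEq, reduceCtorEq, if_false, add_zero]
  rw [Finset.sum_eq_single K]
  · simp
  · intro b _ hb; rw [if_neg hb]
  · simp

/-- Values of the block exponent vector. [folklore] -/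
theorem bordNuBlock_apply_none (J : Fin 3) : bordNuBlock p r J none = r := by
  simp [bordNuBlock]

/-- **The permanent digit pattern.**  If `Σ_I p·e_{g I} ≤ (p,p,p;r)` with `r < p`, then `g = some ∘ σ` for a map
`σ : Fin 3 → Fin 3` with pairwise distinct values, and the difference is `r·e_{none}`. [folklore] -/
theorem exists_of_sum_single_le_bordNuPer (hp : 0 < p) (hr : r < p) (g : Fin 3 → Option (Fin 3))
    (hle : (∑ I, Finsupp.single (g I) p) ≤ bordNuPer p r) :
    ∃ σ : Fin 3 → Fin 3, (g = fun I => some (σ I)) ∧ (σ 0 ≠ σ 1 ∧ σ 0 ≠ σ 2 ∧ σ 1 ≠ σ 2) ∧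
      bordNuPer p r - (∑ I, Finsupp.single (g I) p) = Finsupp.single none r := by
  classical
  have hval : ∀ K : Option (Fin 3), (∑ I, Finsupp.single (g I) p) K = p * (univ.filter fun I => g I = K).card := by
    intro K
    rw [Finsupp.finsetSum_apply, Finset.card_filter, Finset.mul_sum]
    refine Finset.sum_congr rfl fun I _ => ?_
    rw [Finsupp.single_apply]; split_ifs <;> simp
  -- no `I` is mapped to the border
  have hnone : ∀ I, g I ≠ none := by
    intro I hI
    have h := hle none
    rw [hval, bordNuPer_apply_none] at h
    have : 1 ≤ (univ.filter fun I' => g I' = none).card :=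
      Finset.card_pos.mpr ⟨I, by simp [hI]⟩
    nlinarith
  choose σ hσ using fun I => Option.ne_none_iff_exists'.mp (hnone I)
  have hg : g = fun I => some (σ I) := funext hσ
  -- distinct values
  have hinj : ∀ I I', I ≠ I' → σ I ≠ σ I' := by
    intro I I' hII' hσσ
    have h := hle (some (σ I))
    rw [hval, bordNuPer_apply_some] at h
    have : 1 < (univ.filter fun I'' => g I'' = some (σ I)).card := by
      rw [Finset.one_lt_card_iff]
      exact ⟨I, I', by simp [hσ], by simp [hσ, hσσ], hII'⟩
    nlinarith
  refine ⟨σ, hg, ⟨hinj 0 1 (by decide), hinj 0 2 (by decide), hinj 1 2 (by decide)⟩, ?_⟩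
  -- the difference
  have hbij : Function.Bijective σ :=
    Finite.injective_iff_bijective.mp fun a b hab => by_contra fun h => hinj a b h hab
  have hsum : (∑ I, Finsupp.single (g I) p) = ∑ K : Fin 3, Finsupp.single (some K) p := by
    rw [hg]
    exact Fintype.sum_bijective σ hbij _ _ fun _ => rfl
  rw [hsum, bordNuPer, add_tsub_cancel_left]

/-- The expected digit pattern is admissible. [folklore] -/
theorem single_add_single_le_bordNuBlock (J : Fin 3) :
    Finsupp.single (some (J + 1)) p + Finsupp.single (some (J + 2)) p ≤ bordNuBlock p r J := by
  intro K
  rcases K with _ | K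
  · simp [bordNuBlock_apply_none]
  · simp only [Finsupp.coe_add, Pi.add_apply, Finsupp.single_apply, Option.some.injEq,
      bordNuBlock_apply_some]
    have h1 : J + 1 ≠ J := (by decide : ∀ a : Fin 3, a + 1 ≠ a) J
    have h2 : J + 2 ≠ J := (by decide : ∀ a : Fin 3, a + 2 ≠ a) J
    by_cases e1 : J + 1 = K
    · subst e1; simp [h1]
    · by_cases e2 : J + 2 = K
      · subst e2; simp [e1, h2]
      · simp [e1, e2]

/-- **The block digit pattern.**  `p(e_{J₁} + e_{J₂}) ≤ (p,p,p;r) - 2e_J` (`r < p`, `2 < p`)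
iff `{J₁, J₂} = {J+1, J+2}` in the core. [folklore] -/
theorem le_bordNuBlock_iff (hp : 2 < p) (hr : r < p) (J : Fin 3) (J₁ J₂ : Option (Fin 3)) :
    Finsupp.single J₁ p + Finsupp.single J₂ p ≤ bordNuBlock p r J ↔
      (J₁ = some (J + 1) ∧ J₂ = some (J + 2)) ∨ (J₁ = some (J + 2) ∧ J₂ = some (J + 1)) := by
  constructor
  · intro h
    have hK : ∀ K : Option (Fin 3),
        Finsupp.single J₁ p K + Finsupp.single J₂ p K ≤ bordNuBlock p r J K := fun K => h K
    have h1 : J₁ ≠ none := by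
      rintro rfl
      have := hK none
      rw [bordNuBlock_apply_none, Finsupp.single_eq_same] at this
      omega
    have h2 : J₂ ≠ none := by
      rintro rfl
      have := hK none
      rw [bordNuBlock_apply_none, Finsupp.single_eq_same] at this
      omega
    obtain ⟨K₁, rfl⟩ := Option.ne_none_iff_exists'.mp h1
    obtain ⟨K₂, rfl⟩ := Option.ne_none_iff_exists'.mp h2
    have hK₁ := hK (some K₁)
    have hK₂ := hK (some K₂)
    rw [bordNuBlock_apply_some, Finsupp.single_eq_same] at hK₁
    rw [bordNuBlock_apply_some, add_comm, Finsupp.single_eq_same] at hK₂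
    have hne : K₁ ≠ K₂ := by
      rintro rfl
      rw [Finsupp.single_eq_same] at hK₁
      split_ifs at hK₁ <;> omega
    have hK₁J : K₁ ≠ J := by
      rintro rfl
      rw [if_pos rfl] at hK₁
      omega
    have hK₂J : K₂ ≠ J := by
      rintro rfl
      rw [if_pos rfl] at hK₂
      omega
    have key : ∀ a b c : Fin 3, a ≠ b → a ≠ c → b ≠ c →
        (a = c + 1 ∧ b = c + 2) ∨ (a = c + 2 ∧ b = c + 1) := by decide
    rcases key K₁ K₂ J hne hK₁J hK₂J with ⟨ha, hb⟩ | ⟨ha, hb⟩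
    · exact Or.inl ⟨by rw [ha], by rw [hb]⟩
    · exact Or.inr ⟨by rw [ha], by rw [hb]⟩
  · rintro (⟨rfl, rfl⟩ | ⟨rfl, rfl⟩)
    · exact single_add_single_le_bordNuBlock J
    · rw [add_comm]; exact single_add_single_le_bordNuBlock J

/-- The difference in the block digit pattern. [folklore] -/
theorem bordNuBlock_sub (J : Fin 3) :
    bordNuBlock p r J - (Finsupp.single (some (J + 1)) p + Finsupp.single (some (J + 2)) p) =
      Finsupp.single (some J) (p - 2) + Finsupp.single none r := by
  have h1 : J + 1 ≠ J := (by decide : ∀ a : Fin 3, a + 1 ≠ a) J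
  have h2 : J + 2 ≠ J := (by decide : ∀ a : Fin 3, a + 2 ≠ a) J
  have h12 : J + 1 ≠ J + 2 := (by decide : ∀ a : Fin 3, a + 1 ≠ a + 2) J
  have hcov : ∀ K : Fin 3, K ≠ J → K ≠ J + 1 → K = J + 2 :=
    (by decide : ∀ a K : Fin 3, K ≠ a → K ≠ a + 1 → K = a + 2) J
  ext K
  simp only [Finsupp.coe_tsub, Finsupp.coe_add, Pi.sub_apply, Pi.add_apply, Finsupp.single_apply]
  rcases K with _ | K
  · simp [bordNuBlock_apply_none]
  · rw [bordNuBlock_apply_some]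
    simp only [Option.some.injEq, reduceCtorEq, if_false, add_zero]
    by_cases hKJ : K = J
    · subst hKJ
      simp [h1, h2]
    · rw [if_neg hKJ]
      by_cases hK1 : K = J + 1
      · subst hK1; simp [Ne.symm hKJ]
      · have hK2 := hcov K hKJ hK1
        subst hK2; simp [h12, Ne.symm hKJ]

end Exponents

end Summit.ValiantsHypothesis.ValiantsHypothesis.Theorems.GrenetZeonHessianRankCodimTwo
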